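import Mathlib
import Literature.Probability.Process.PointStationaryLaw
import Literature.Geometry.DiscreteGeometry.CrystallographicGroups

/-!
# Stub `stub_slabOrDense` of line `purity_stacking` — crux `IsometryAtoms.MinimisingLawsCohesive`
# (stmt-AtomisticToContinuum-15777)

Deterministic dichotomy closing the purity/stacking argument: a rooted hard-core copy
`μ = count|A(Y − q)` of a point set `Y ⊆ ℝ³` with finitely many symmetry orbits is either
*relatively dense* or a *slab*, granted (as hypotheses, supplied by the neighbouring stubs)
the discontinuity of the symmetry group of a separated non-coplanar set and the structure
theorem for discontinuous groups of isometries of `ℝ³` (three independent translations, or an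
invariant point/line/plane).

Mechanism.
* `Y` coplanar ⇒ slab directly.
* `Y` non-coplanar: its symmetry group `Γ = {g | g '' Y = Y}` is discontinuous, so either
  (a) it contains three independent translations: then `Y` (hence `A(Y − q)`) is invariant under
  a full lattice, and the `ZSpan` floor/fract decomposition gives relative density; or
  (b) it leaves a nonempty affine subspace `V` of dimension `≤ 2` invariant: distances to `V` are
  `Γ`-invariant, finitely many orbits bound them on `Y`, and `V` lies in a plane, so `Y` is
  within bounded distance of a plane ⇒ slab.

Lands at `Summits/AtomisticToContinuum/Crystallization/Theorems/` as
`IsometryAtomsMinimisingLawsCohesiveSlabOrDense.lean` with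
`--supports stmt-AtomisticToContinuum-15777`.
-/

noncomputable section

open MeasureTheory
open scoped ENNReal

namespace Summit.AtomisticToContinuum.Crystallization.Theorems.IsometryAtomsMinimisingLawsCohesive

namespace SlabOrDense

open Literature.Geometry.DiscreteGeometry.Crystallographic

/-- **Slab criterion.** If all points of `Z` have bounded inner product with a unit vector `u`,
then after a linear isometry (an orthonormal change of coordinates whose `i₀`-th basis vector is
`u`) their `i₀`-th coordinates are bounded by the same constant. -/
theorem slab_of_inner_bound {ι : Type*} [Fintype ι] {Z : Set (EuclideanSpace ℝ ι)}
    {u : EuclideanSpace ℝ ι} (hu : ‖u‖ = 1) {D : ℝ} (hD : ∀ z ∈ Z, |inner ℝ z u| ≤ D) (i₀ : ι) :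
    ∃ B : EuclideanSpace ℝ ι →ₗᵢ[ℝ] EuclideanSpace ℝ ι, ∀ z ∈ Z, |B z i₀| ≤ D := by
  have hon : Orthonormal ℝ (({i₀} : Set ι).restrict fun _ : ι => u) := by
    rw [orthonormal_subsingleton_iff]
    intro i
    exact hu
  obtain ⟨b, hb⟩ := hon.exists_orthonormalBasis_extension_of_card_eq
    (by simp [finrank_euclideanSpace])
  have hb0 : b i₀ = u := hb i₀ rfl
  refine ⟨b.repr.toLinearIsometry, fun z hz => ?_⟩
  have h : b.repr.toLinearIsometry z i₀ = inner ℝ z u := by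
    rw [LinearIsometryEquiv.coe_toLinearIsometry, OrthonormalBasis.repr_apply_apply, hb0]
    exact real_inner_comm _ _
  rw [h]
  exact hD z hz

/-- A bound `|⟪y, u⟫| ≤ D` on `Y` transfers to the rooted copy `A(Y − q)` (`q ∈ Y`) as the
bound `|⟪z, A u⟫| ≤ D + D`. -/
theorem inner_bound_image {E : Type*} [NormedAddCommGroup E] [InnerProductSpace ℝ E]
    {Y : Set E} {u : E} {D : ℝ} (hD : ∀ y ∈ Y, |inner ℝ y u| ≤ D)
    (A : E →ₗᵢ[ℝ] E) {q : E} (hq : q ∈ Y) :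
    ∀ z ∈ (fun s => A (s - q)) '' Y, |inner ℝ z (A u)| ≤ D + D := by
  rintro _ ⟨s, hs, rfl⟩
  rw [LinearIsometry.inner_map_map, inner_sub_left]
  exact (abs_sub _ _).trans (add_le_add (hD s hs) (hD q hq))

/-- The symmetry group `{g | g '' Y = Y}` of a set `Y`, as a subgroup of the isometry group
(existence form, to avoid a definition). -/
theorem exists_symSubgroup {α : Type*} [PseudoEMetricSpace α] (Y : Set α) :
    ∃ Γ : Subgroup (α ≃ᵢ α), ∀ g, g ∈ Γ ↔ g '' Y = Y := by
  refine ⟨{ carrier := {g | g '' Y = Y}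
            mul_mem' := fun {g h} hg hh => ?_
            one_mem' := ?_
            inv_mem' := fun {g} hg => ?_ }, fun g => Iff.rfl⟩
  · simp only [Set.mem_setOf_eq] at hg hh ⊢
    rw [IsometryEquiv.coe_mul, Set.image_comp, hh, hg]
  · simp only [Set.mem_setOf_eq, IsometryEquiv.coe_one, Set.image_id]
  · simp only [Set.mem_setOf_eq] at hg ⊢
    calc ⇑(g⁻¹) '' Y = ⇑(g⁻¹) '' (g '' Y) := by rw [hg]
      _ = Y := by
        rw [Set.image_image]
        simp only [IsometryEquiv.inv_apply_self, Set.image_id']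

/-- **Discontinuity of the symmetry group** from the finiteness hypothesis on affine
symmetries moving some point of a ball into the ball (Mazur–Ulam identifies the two kinds of
self-isometries of `ℝⁿ`). -/
theorem isDiscontinuous_of_finite {n : ℕ} {Y : Set (EuclideanSpace ℝ (Fin n))}
    (hfin : ∀ R : ℝ, {g : EuclideanSpace ℝ (Fin n) ≃ᵃⁱ[ℝ] EuclideanSpace ℝ (Fin n) |
      g '' Y = Y ∧ ∃ x : EuclideanSpace ℝ (Fin n), ‖x‖ ≤ R ∧ ‖g x‖ ≤ R}.Finite)
    {Γ : Subgroup (EuclideanSpace ℝ (Fin n) ≃ᵢ EuclideanSpace ℝ (Fin n))}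
    (hΓ : ∀ g, g ∈ Γ ↔ g '' Y = Y) :
    IsDiscontinuous Γ := by
  intro K hK
  obtain ⟨R, hR⟩ := hK.isBounded.subset_closedBall (0 : EuclideanSpace ℝ (Fin n))
  have hinj : Function.Injective
      (fun g : EuclideanSpace ℝ (Fin n) ≃ᵢ EuclideanSpace ℝ (Fin n) =>
        g.toRealAffineIsometryEquiv) := by
    intro g h hgh
    rw [← IsometryEquiv.coe_toRealAffineIsometryEquiv g,
      ← IsometryEquiv.coe_toRealAffineIsometryEquiv h]
    exact congrArg AffineIsometryEquiv.toIsometryEquiv hgh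
  refine ((hfin R).preimage hinj.injOn).subset ?_
  rintro g ⟨hgΓ, _, ⟨x, hxK, rfl⟩, hgxK⟩
  simp only [Set.mem_preimage, Set.mem_setOf_eq, IsometryEquiv.coeFn_toRealAffineIsometryEquiv]
  exact ⟨(hΓ g).1 hgΓ, x, mem_closedBall_zero_iff.1 (hR hxK),
    mem_closedBall_zero_iff.1 (hR hgxK)⟩

/-- **Lattice case ⇒ relative density.** If `Y ∋ q` is invariant (both ways) under `dim E`
linearly independent translations `vᵢ`, then every point of space is within `∑ ‖vᵢ‖` of the
rooted copy `A(Y − q)`: decompose `A⁻¹ z` into its `ZSpan` floor (a period) and fractional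
part. -/
theorem dense_of_translations {E : Type*} [NormedAddCommGroup E] [NormedSpace ℝ E]
    [FiniteDimensional ℝ E] {ι : Type*} [Fintype ι] {Y : Set E} {v : ι → E}
    (hv : LinearIndependent ℝ v) (hcard : Fintype.card ι = Module.finrank ℝ E)
    (hY : ∀ i, ∀ y ∈ Y, y + v i ∈ Y ∧ y - v i ∈ Y) (A : E →ₗᵢ[ℝ] E) {q : E} (hq : q ∈ Y) :
    ∃ R₀ : ℝ, ∀ z : E, ∃ y ∈ (fun s => A (s - q)) '' Y, dist z y ≤ R₀ := by
  -- the two-sided periods of `Y` form an additive subgroup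
  let T : AddSubgroup E :=
    { carrier := {w | ∀ y ∈ Y, y + w ∈ Y ∧ y - w ∈ Y}
      add_mem' := fun {a b} ha hb => by
        simp only [Set.mem_setOf_eq] at ha hb ⊢
        intro y hy
        refine ⟨?_, ?_⟩
        · rw [← add_assoc]
          exact (hb _ (ha y hy).1).1
        · rw [← sub_sub]
          exact (hb _ (ha y hy).2).2
      zero_mem' := by
        simp only [Set.mem_setOf_eq, add_zero, sub_zero]
        exact fun y hy => ⟨hy, hy⟩
      neg_mem' := fun {a} ha => by
        simp only [Set.mem_setOf_eq] at ha ⊢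
        intro y hy
        rw [← sub_eq_add_neg, sub_neg_eq_add]
        exact ⟨(ha y hy).2, (ha y hy).1⟩ }
  let b := basisOfLinearIndependentOfCardEqFinrank' v hv hcard
  have hb : ⇑b = v := coe_basisOfLinearIndependentOfCardEqFinrank' v hv hcard
  have hspan : ∀ w ∈ Submodule.span ℤ (Set.range ⇑b), w ∈ T := by
    intro w hw
    induction hw using Submodule.span_induction with
    | mem x hx =>
      obtain ⟨i, rfl⟩ := hx
      rw [hb]
      exact hY i
    | zero => exact T.zero_mem
    | add x y _ _ hx hy => exact T.add_mem hx hy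
    | smul a x _ hx => exact T.zsmul_mem hx a
  refine ⟨∑ i, ‖b i‖, fun z => ?_⟩
  obtain ⟨x, hx⟩ : ∃ x : E, A x = z :=
    ⟨(A.toLinearIsometryEquiv rfl).symm z, (A.toLinearIsometryEquiv rfl).apply_symm_apply z⟩
  have hℓT : ((ZSpan.floor b x : Submodule.span ℤ (Set.range ⇑b)) : E) ∈ T :=
    hspan _ (ZSpan.floor b x).2
  refine ⟨A (ZSpan.floor b x : E), ⟨q + (ZSpan.floor b x : E), (hℓT q hq).1, ?_⟩, ?_⟩
  · show A (q + (ZSpan.floor b x : E) - q) = A (ZSpan.floor b x : E)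
    rw [add_sub_cancel_left]
  · rw [← hx, A.dist_map, dist_eq_norm, ← ZSpan.fract_apply]
    exact ZSpan.norm_fract_le b x

/-- **Invariant-subspace case ⇒ slab direction.** If the symmetries of `Y` have finitely many
orbit representatives `S` and leave a nonempty proper affine subspace `V` invariant, then `Y` has
bounded inner product with a unit normal `u` of a hyperplane containing `V`. -/
theorem inner_bound_of_invariant {E : Type*} [NormedAddCommGroup E] [InnerProductSpace ℝ E]
    [FiniteDimensional ℝ E] {Y : Set E} {S : Finset E}
    (hS : ∀ x ∈ Y, ∃ g : E ≃ᵃⁱ[ℝ] E, g '' Y = Y ∧ g x ∈ (S : Set E))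
    {V : AffineSubspace ℝ E} (hVne : (V : Set E).Nonempty)
    (hVdim : Module.finrank ℝ V.direction < Module.finrank ℝ E)
    (hVinv : ∀ g : E ≃ᵃⁱ[ℝ] E, g '' Y = Y → g '' (V : Set E) = V) :
    ∃ u : E, ‖u‖ = 1 ∧ ∃ D : ℝ, ∀ y ∈ Y, |inner ℝ y u| ≤ D := by
  -- a unit normal `u` to a hyperplane containing `V`
  have hpos : 0 < Module.finrank ℝ V.directionᗮ := by
    have h3 := Submodule.finrank_add_finrank_orthogonal V.direction
    omega
  obtain ⟨n, hn⟩ := Module.finrank_pos_iff_exists_ne_zero.1 hpos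
  have hn0 : (n : E) ≠ 0 := fun h => hn (Submodule.coe_eq_zero.1 h)
  obtain ⟨u, hu1, huK⟩ : ∃ u : E, ‖u‖ = 1 ∧ u ∈ V.directionᗮ :=
    ⟨‖(n : E)‖⁻¹ • (n : E),
      by rw [norm_smul, norm_inv, norm_norm, inv_mul_cancel₀ (norm_ne_zero_iff.2 hn0)],
      Submodule.smul_mem _ _ n.2⟩
  obtain ⟨p, hp⟩ := hVne
  -- the normal component relative to `p ∈ V` is dominated by the distance to `V`
  have hkey : ∀ x : E, |inner ℝ (x - p) u| ≤ Metric.infDist x (V : Set E) := by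
    intro x
    refine (Metric.le_infDist ⟨p, hp⟩).2 fun w hw => ?_
    have hwp : w - p ∈ V.direction := by
      simpa only [vsub_eq_sub] using AffineSubspace.vsub_mem_direction hw hp
    have hw0 : inner ℝ (w - p) u = 0 := Submodule.inner_right_of_mem_orthogonal hwp huK
    have hxw : inner ℝ (x - p) u = inner ℝ (x - w) u := by
      rw [← sub_add_sub_cancel x w p, inner_add_left, hw0, add_zero]
    rw [hxw, dist_eq_norm]
    calc |inner ℝ (x - w) u| ≤ ‖x - w‖ * ‖u‖ := abs_real_inner_le_norm _ _
      _ = ‖x - w‖ := by rw [hu1, mul_one]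
  refine ⟨u, hu1, (∑ s ∈ S, Metric.infDist s (V : Set E)) + |inner ℝ p u|, fun y hy => ?_⟩
  obtain ⟨g, hgY, hgS⟩ := hS y hy
  -- distances to `V` are invariant under symmetries, hence bounded via the representatives
  have hinv : Metric.infDist (g y) (V : Set E) = Metric.infDist y (V : Set E) := by
    conv_lhs => rw [← hVinv g hgY]
    exact Metric.infDist_image g.isometry
  have hle : Metric.infDist y (V : Set E) ≤ ∑ s ∈ S, Metric.infDist s (V : Set E) := by
    rw [← hinv]
    exact Finset.single_le_sum (f := fun s => Metric.infDist s (V : Set E))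
      (fun s _ => Metric.infDist_nonneg) (Finset.mem_coe.1 hgS)
  have hyp : inner ℝ y u = inner ℝ (y - p) u + inner ℝ p u := by
    rw [← inner_add_left, sub_add_cancel]
  rw [hyp]
  calc |inner ℝ (y - p) u + inner ℝ p u|
      ≤ |inner ℝ (y - p) u| + |inner ℝ p u| := abs_add_le _ _
    _ ≤ (∑ s ∈ S, Metric.infDist s (V : Set E)) + |inner ℝ p u| := by
      have := hkey y
      linarith

end SlabOrDense

open SlabOrDense in
/-- **Stub `stub_slabOrDense`** of line `purity_stacking` (crux
`IsometryAtoms.MinimisingLawsCohesive`, stmt-AtomisticToContinuum-15777): **deterministic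
dichotomy "relatively dense or slab".**

Hypotheses: (1) for `δ > 0` and a `δ`-separated, non-coplanar `Y ⊆ ℝ³`, only finitely many
affine self-isometries `g` with `g '' Y = Y` move some point of the `R`-ball into the `R`-ball;
(2) every discontinuous group `Γ` of isometries of `ℝ³` has bounded finite subgroups and either
contains three linearly independent translations or leaves a nonempty affine subspace of
dimension `≤ 2` invariant. Conclusion: for `δ > 0`, a set `Y` with finitely many symmetry
orbits, and a `δ`-hard-core rooted copy `μ = count|A(Y − q)` (`A` a linear isometry, `q ∈ Y`),
either `μ` is relatively dense (every point of space is within `R₀` of an atom) or `μ` is a slab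
(after a linear isometry the `0`-th coordinates of the atoms are bounded).

Proof: atoms of `μ` are exactly `Z = A(Y − q)` (`count_restrict_singleton_ne_zero_iff`), so `Y`
is `δ`-separated. If `Y` is coplanar it is a slab (`slab_of_inner_bound`). Otherwise its
symmetry group (`exists_symSubgroup`) is discontinuous (`isDiscontinuous_of_finite`, via (1)); by
(2) either three independent translations preserve `Y`, whence relative density
(`dense_of_translations`, `ZSpan` floor/fract), or an invariant low-dimensional affine subspace
bounds the normal component of `Y` (`inner_bound_of_invariant`), whence a slab. -/
theorem stub_slabOrDense :
    (∀ δ : ℝ, 0 < δ → ∀ Y : Set (EuclideanSpace ℝ (Fin 3)),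
      (∀ x ∈ Y, ∀ y ∈ Y, x ≠ y → δ ≤ dist x y) →
      (¬ ∃ n : EuclideanSpace ℝ (Fin 3), n ≠ 0 ∧ ∃ c : ℝ, ∀ y ∈ Y, inner ℝ y n = c) →
      ∀ R : ℝ, {g : EuclideanSpace ℝ (Fin 3) ≃ᵃⁱ[ℝ] EuclideanSpace ℝ (Fin 3) |
        g '' Y = Y ∧ ∃ x : EuclideanSpace ℝ (Fin 3), ‖x‖ ≤ R ∧ ‖g x‖ ≤ R}.Finite) →
    (∀ Γ : Subgroup (EuclideanSpace ℝ (Fin 3) ≃ᵢ EuclideanSpace ℝ (Fin 3)),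
      Literature.Geometry.DiscreteGeometry.Crystallographic.IsDiscontinuous Γ →
      (∃ N : ℕ, ∀ H : Subgroup (EuclideanSpace ℝ (Fin 3) ≃ᵢ EuclideanSpace ℝ (Fin 3)),
          H ≤ Γ → Finite H → Nat.card H ≤ N) ∧
      ((∃ v : Fin 3 → EuclideanSpace ℝ (Fin 3),
          LinearIndependent ℝ v ∧ ∀ i, IsometryEquiv.addRight (v i) ∈ Γ) ∨
       (∃ V : AffineSubspace ℝ (EuclideanSpace ℝ (Fin 3)),
          (V : Set (EuclideanSpace ℝ (Fin 3))).Nonempty ∧ Module.finrank ℝ V.direction ≤ 2 ∧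
          ∀ g ∈ Γ, g '' (V : Set (EuclideanSpace ℝ (Fin 3))) = V))) →
    ∀ δ : ℝ, 0 < δ → ∀ Y : Set (EuclideanSpace ℝ (Fin 3)),
      (∃ S : Finset (EuclideanSpace ℝ (Fin 3)), ∀ x ∈ Y,
            ∃ g : EuclideanSpace ℝ (Fin 3) ≃ᵃⁱ[ℝ] EuclideanSpace ℝ (Fin 3),
              g '' Y = Y ∧ g x ∈ (S : Set (EuclideanSpace ℝ (Fin 3)))) →
      ∀ μ : MeasureTheory.Measure (EuclideanSpace ℝ (Fin 3)),
        (∃ A : EuclideanSpace ℝ (Fin 3) →ₗᵢ[ℝ] EuclideanSpace ℝ (Fin 3), ∃ q ∈ Y,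
          μ = (MeasureTheory.Measure.count : MeasureTheory.Measure (EuclideanSpace ℝ (Fin 3))).restrict
            ((fun s => A (s - q)) '' Y)) →
        Literature.Probability.Process.IsRootedHardCore δ μ →
        (∃ R₀ : ℝ, ∀ z : EuclideanSpace ℝ (Fin 3), ∃ y : EuclideanSpace ℝ (Fin 3),
            μ {y} ≠ 0 ∧ dist z y ≤ R₀) ∨
        (∃ A : EuclideanSpace ℝ (Fin 3) →ₗᵢ[ℝ] EuclideanSpace ℝ (Fin 3), ∃ D : ℝ,
            ∀ y : EuclideanSpace ℝ (Fin 3), μ {y} ≠ 0 → |A y 0| ≤ D) := by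
  intro hSym hGroup δ hδ Y hOrb μ hμA hHC
  obtain ⟨S, hS⟩ := hOrb
  obtain ⟨A, q, hq, hμ⟩ := hμA
  -- atoms of `μ` are exactly the points of `Z = A(Y − q)`
  have hatom : ∀ y, μ {y} ≠ 0 ↔ y ∈ (fun s => A (s - q)) '' Y := fun y => by
    rw [hμ]
    exact Literature.Probability.Process.count_restrict_singleton_ne_zero_iff _ y
  -- `Y` is `δ`-separated (hard core of `μ`, transported back by the isometry `A`)
  have hsepY : ∀ x ∈ Y, ∀ y ∈ Y, x ≠ y → δ ≤ dist x y := by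
    obtain ⟨S', -, hsep', hμ'⟩ := hHC
    have hS'Z : ∀ y, y ∈ S' ↔ y ∈ (fun s => A (s - q)) '' Y := fun y => by
      rw [← Literature.Probability.Process.count_restrict_singleton_ne_zero_iff S' y, ← hμ']
      exact hatom y
    intro x hx y hy hxy
    have hxZ : A (x - q) ∈ S' := (hS'Z _).2 ⟨x, hx, rfl⟩
    have hyZ : A (y - q) ∈ S' := (hS'Z _).2 ⟨y, hy, rfl⟩
    have hne : A (x - q) ≠ A (y - q) := fun h => hxy (sub_left_inj.1 (A.injective h))
    have h := hsep' _ hxZ _ hyZ hne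
    rwa [A.dist_map, dist_sub_right] at h
  rcases em (∃ v : Fin 3 → EuclideanSpace ℝ (Fin 3),
      LinearIndependent ℝ v ∧ ∀ i, ∀ y ∈ Y, y + v i ∈ Y ∧ y - v i ∈ Y) with ⟨v, hv, hY⟩ | hnolat
  · -- a full period lattice: relatively dense
    left
    obtain ⟨R₀, hR₀⟩ := dense_of_translations hv (by simp) hY A hq
    refine ⟨R₀, fun z => ?_⟩
    obtain ⟨y, hyZ, hzy⟩ := hR₀ z
    exact ⟨y, (hatom y).2 hyZ, hzy⟩
  · -- otherwise `Y` has bounded normal component in some unit direction: slab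
    right
    obtain ⟨u, hu, D, hD⟩ :
        ∃ u : EuclideanSpace ℝ (Fin 3), ‖u‖ = 1 ∧ ∃ D : ℝ, ∀ y ∈ Y, |inner ℝ y u| ≤ D := by
      by_cases hcop : ∃ n : EuclideanSpace ℝ (Fin 3), n ≠ 0 ∧ ∃ c : ℝ, ∀ y ∈ Y, inner ℝ y n = c
      · -- coplanar
        obtain ⟨n, hn, c, hc⟩ := hcop
        refine ⟨‖n‖⁻¹ • n, by rw [norm_smul, norm_inv, norm_norm,
          inv_mul_cancel₀ (norm_ne_zero_iff.2 hn)], |‖n‖⁻¹ * c|, fun y hy => ?_⟩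
        rw [real_inner_smul_right, hc y hy]
      · -- non-coplanar: use the structure of the (discontinuous) symmetry group
        obtain ⟨Γ, hΓ⟩ := exists_symSubgroup Y
        have hdisc := isDiscontinuous_of_finite (hSym δ hδ Y hsepY hcop) hΓ
        obtain ⟨-, ⟨v, hv, hvΓ⟩ | ⟨V, hVne, hVdim, hVinv⟩⟩ := hGroup Γ hdisc
        · refine absurd ⟨v, hv, fun i y hy => ?_⟩ hnolat
          have himg : (IsometryEquiv.addRight (v i)) '' Y = Y := (hΓ _).1 (hvΓ i)
          refine ⟨?_, ?_⟩
          · have h1 : IsometryEquiv.addRight (v i) y ∈ (IsometryEquiv.addRight (v i)) '' Y :=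
              Set.mem_image_of_mem _ hy
            rwa [himg, IsometryEquiv.addRight_apply] at h1
          · have h2 : y ∈ (IsometryEquiv.addRight (v i)) '' Y := by rw [himg]; exact hy
            obtain ⟨y', hy', hyy'⟩ := h2
            rw [IsometryEquiv.addRight_apply] at hyy'
            rw [← hyy', add_sub_cancel_right]
            exact hy'
        · have hVinv' : ∀ g : EuclideanSpace ℝ (Fin 3) ≃ᵃⁱ[ℝ] EuclideanSpace ℝ (Fin 3),
              g '' Y = Y → g '' (V : Set (EuclideanSpace ℝ (Fin 3))) = V := by
            intro g hg
            have h := hVinv g.toIsometryEquiv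
              ((hΓ _).2 (by rw [AffineIsometryEquiv.coe_toIsometryEquiv]; exact hg))
            rwa [AffineIsometryEquiv.coe_toIsometryEquiv] at h
          have hVdim' : Module.finrank ℝ V.direction <
              Module.finrank ℝ (EuclideanSpace ℝ (Fin 3)) := by
            rw [finrank_euclideanSpace_fin]
            omega
          exact inner_bound_of_invariant hS hVne hVdim' hVinv'
    obtain ⟨B, hB⟩ := slab_of_inner_bound (Z := (fun s => A (s - q)) '' Y) (u := A u)
      (by rw [A.norm_map, hu]) (inner_bound_image hD A hq) 0
    exact ⟨B, D + D, fun y hy => hB y ((hatom y).1 hy)⟩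

end Summit.AtomisticToContinuum.Crystallization.Theorems.IsometryAtomsMinimisingLawsCohesive

end
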